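import Mathlib
import Literature.NumberTheory.Transcendental.ZagierDilogarithmConjecture
import Literature.NumberTheory.Transcendental.BlochWignerDilogarithm
import Literature.NumberTheory.Transcendental.BlochWignerDilogarithmProofs
import HarnessLib

/-!
# Galois propagation is automatic over a conjugation-closed field with one complex place

Helper for the stub `stub_galoisPropagation` (OPEN CORE (b)) of the line
`kummer-clausen-linearisation` for the crux `ZagierDilogarithmConjecture`
(stmt-KontsevichZagierPeriods-10550, route `HyperbolicBloch`), generation 2.

`stub_galoisPropagationOneComplexPlace`: let `K ⊆ ℂ` be a subfield of algebraic numbers, stable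
under complex conjugation, all of whose embeddings `τ : K → ℂ` are the inclusion, the complex
conjugate of the inclusion, or real-valued ("one complex place"; e.g. every imaginary quadratic
field, or `ℚ(i√(√2 − 1))`). If `u₁, …, u_k ∈ K ∩ ℍ⁺` and `Σ mᵢ D(uᵢ) = 0`, then for every
`ℚ`-embedding `σ : ℚ̄ → ℂ` and lifts `wᵢ, w'ᵢ ∈ ℚ̄` of `uᵢ, ūᵢ` one has
`Σ mᵢ (D(σwᵢ) − D(σw'ᵢ)) = 0`: the restriction `τ = σ|_K` is one of the three kinds, giving the sum
`2 Σ mᵢ D(uᵢ)`, `−2 Σ mᵢ D(uᵢ)` (`D(z̄) = −D(z)`), or `0` (`D` vanishes on `ℝ`). So on such fields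
the open core (b) is vacuous and Zagier's conjecture reduces to Dehn rigidity (a) modulo Borel and
Suslin (cf. `stub_imaginaryQuadraticSectorIff`).
-/

noncomputable section

open scoped BigOperators ComplexConjugate
open Literature.NumberTheory.Transcendental

namespace Summit.KontsevichZagierPeriods.HyperbolicBloch.ZagierDilogarithm

/-- Restriction of a `ℚ`-embedding `σ : ℚ̄ → ℂ` to a subfield `K ⊆ ℂ` of algebraic numbers, as a
ring homomorphism `K → ℂ`. [folklore] -/
theorem exists_restrict_ringHom (K : Subfield ℂ) (hKa : ∀ z ∈ K, IsAlgebraic ℚ z)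
    (σ : ↥(algebraicClosure ℚ ℂ) →ₐ[ℚ] ℂ) :
    ∃ τ : K →+* ℂ, ∀ (x : K) (X : ↥(algebraicClosure ℚ ℂ)), (X : ℂ) = x → τ x = σ X := by
  have hmem : ∀ x : K, (x : ℂ) ∈ algebraicClosure ℚ ℂ :=
    fun x => mem_algebraicClosure_iff.2 (hKa x x.2)
  refine ⟨{ toFun := fun x => σ ⟨x, hmem x⟩
            map_one' := by
              rw [← map_one σ]
              exact congrArg σ (Subtype.ext (by simp))
            map_mul' := fun a b => by
              rw [← map_mul σ]
              exact congrArg σ (Subtype.ext (by simp))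
            map_zero' := by
              rw [← map_zero σ]
              exact congrArg σ (Subtype.ext (by simp))
            map_add' := fun a b => by
              rw [← map_add σ]
              exact congrArg σ (Subtype.ext (by simp)) }, fun x X hX => ?_⟩
  change σ ⟨x, hmem x⟩ = σ X
  exact congrArg σ (Subtype.ext (by simp [hX]))

/-- **Registered sub-goal `stub_galoisPropagationOneComplexPlace`: Galois propagation over a
conjugation-closed subfield of algebraic numbers with one complex place (an unconditional case of
`stub_galoisPropagation`).** If every embedding `τ : K → ℂ` is the inclusion, its complex
conjugate, or real-valued, then a vanishing `ℤ`-combination `Σ mᵢ D(uᵢ)` at points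
`uᵢ ∈ K ∩ ℍ⁺` stays vanishing, anti-symmetrised, under every `ℚ`-embedding of `ℚ̄`.
[cite: Neumann1998, §2, Thm. 2.4 and p. 7] -/
theorem stub_galoisPropagationOneComplexPlace :
    ∀ (K : Subfield ℂ), (∀ z ∈ K, IsAlgebraic ℚ z) → (∀ z ∈ K, conj z ∈ K) →
      (∀ τ : K →+* ℂ, (∀ x : K, τ x = x) ∨ (∀ x : K, τ x = conj (x : ℂ)) ∨
        (∀ x : K, (τ x).im = 0)) →
      ∀ (k : ℕ) (u : Fin k → ℂ) (m : Fin k → ℤ), (∀ i, u i ∈ K) → (∀ i, 0 < (u i).im) →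
        ∑ i, (m i : ℝ) * blochWignerDilog (u i) = 0 →
          ∀ (σ : ↥(algebraicClosure ℚ ℂ) →ₐ[ℚ] ℂ) (w w' : Fin k → ↥(algebraicClosure ℚ ℂ)),
            (∀ i, (w i : ℂ) = u i) → (∀ i, (w' i : ℂ) = conj (u i)) →
            ∑ i, (m i : ℝ) * (blochWignerDilog (σ (w i)) - blochWignerDilog (σ (w' i))) = 0 := by
  intro K hKa hKc hK1 k u m huK him hsum σ w w' hw hw'
  obtain ⟨τ, hτ⟩ := exists_restrict_ringHom K hKa σ
  have hσw : ∀ i, σ (w i) = τ ⟨u i, huK i⟩ := fun i => (hτ ⟨u i, huK i⟩ (w i) (hw i)).symm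
  have hσw' : ∀ i, σ (w' i) = τ ⟨conj (u i), hKc _ (huK i)⟩ :=
    fun i => (hτ ⟨conj (u i), hKc _ (huK i)⟩ (w' i) (hw' i)).symm
  rcases hK1 τ with h | h | h
  · -- `τ` is the inclusion: the sum is `2 Σ mᵢ D(uᵢ)`
    have e : ∀ i, blochWignerDilog (σ (w i)) - blochWignerDilog (σ (w' i)) =
        2 * blochWignerDilog (u i) := fun i => by
      rw [hσw i, hσw' i, h, h]
      change blochWignerDilog (u i) - blochWignerDilog (conj (u i)) = _
      rw [blochWignerDilog_conj (him i).ne']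
      ring
    simp only [e]
    calc ∑ i, (m i : ℝ) * (2 * blochWignerDilog (u i))
        = 2 * ∑ i, (m i : ℝ) * blochWignerDilog (u i) := by
          rw [Finset.mul_sum]
          exact Finset.sum_congr rfl fun i _ => by ring
      _ = 0 := by rw [hsum, mul_zero]
  · -- `τ` is the conjugate inclusion: the sum is `−2 Σ mᵢ D(uᵢ)`
    have e : ∀ i, blochWignerDilog (σ (w i)) - blochWignerDilog (σ (w' i)) =
        -2 * blochWignerDilog (u i) := fun i => by
      rw [hσw i, hσw' i, h, h]
      change blochWignerDilog (conj (u i)) - blochWignerDilog (conj (conj (u i))) = _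
      rw [Complex.conj_conj, blochWignerDilog_conj (him i).ne']
      ring
    simp only [e]
    calc ∑ i, (m i : ℝ) * (-2 * blochWignerDilog (u i))
        = -2 * ∑ i, (m i : ℝ) * blochWignerDilog (u i) := by
          rw [Finset.mul_sum]
          exact Finset.sum_congr rfl fun i _ => by ring
      _ = 0 := by rw [hsum, mul_zero]
  · -- `τ` is real: every term vanishes
    refine Finset.sum_eq_zero fun i _ => ?_
    rw [hσw i, hσw' i, blochWignerDilog_of_im_eq_zero (h _), blochWignerDilog_of_im_eq_zero (h _),
      sub_self, mul_zero]

end Summit.KontsevichZagierPeriods.HyperbolicBloch.ZagierDilogarithm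

end
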